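import Summits.CriticalPhenomena.PercolationContinuityZ3.Theorems.PercNearOneGluingNoHeavyPcintChainMemZ6C10Defs
import HarnessLib

/-!
# PCINT lane, kernel reduced-state B3c certificate `Z6C10` (bond, d = 6, memory τ = 10, kc = 4, 6192 state classes): row checks 1 (rows [0, 600))

Cell `prim-pcint`, seat `prim-pcint-2` (gen 4); memo `run/shared/lean/prim/pcint/REDUCTIONS.md` §B3c and HANDOFF ("B3c on reduced states").
Does NOT build on p205010.  Data for `BondK.le_criticalProb_of_checkRowsC` (`…PcintChainMemKernelCert`): `p = 9305/100000`, chain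
parameter `kc = 4`, `s̄ = 99567/100000` (`s̄²+p² ≥ 1`), refund `r = 100435/100000` (`s̄·r ≥ 1`, `(1-p)·r² ≤ 1`), `κ̄ = (100000²+99567²)/(2·100000²)`,
`λ = 99999/100000`; Collatz–Wielandt weights (scale 10⁹) from a power iteration (ρ ≈ 0.9998183), exact off-line max row ratio
0.9998183042 < λ.  Generated by work/gen/gen_b3c_kernel.py (prim-pcint-2 gen 4 folder; copy in
run/shared/lean/prim/pcint/prim-pcint-2/kernel/); the kernel re-checks every row.
-/

namespace Summit.CriticalPhenomena.PercolationContinuityZ3.Theorems.Pcint.ChainMemZ6C10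

set_option maxHeartbeats 0 in
/-- Rows `[0, 100)` pass the check. [folklore] -/
theorem chk_0 : WinK.allRange (BondK.checkRowC 10 4 6 6192 9305 100435 99567 100000 99999 100000 ChainMemZ6C10.syms ChainMemZ6C10.tree) 0 100 = true :=
  WinK.allRange_of_allRangeB (fuel := 8) (lo := 0) (len := 100) (by decide +kernel)

set_option maxHeartbeats 0 in
/-- Rows `[100, 200)` pass the check. [folklore] -/
theorem chk_100 : WinK.allRange (BondK.checkRowC 10 4 6 6192 9305 100435 99567 100000 99999 100000 ChainMemZ6C10.syms ChainMemZ6C10.tree) 100 200 = true :=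
  WinK.allRange_of_allRangeB (fuel := 8) (lo := 100) (len := 100) (by decide +kernel)

set_option maxHeartbeats 0 in
/-- Rows `[200, 300)` pass the check. [folklore] -/
theorem chk_200 : WinK.allRange (BondK.checkRowC 10 4 6 6192 9305 100435 99567 100000 99999 100000 ChainMemZ6C10.syms ChainMemZ6C10.tree) 200 300 = true :=
  WinK.allRange_of_allRangeB (fuel := 8) (lo := 200) (len := 100) (by decide +kernel)

set_option maxHeartbeats 0 in
/-- Rows `[300, 400)` pass the check. [folklore] -/
theorem chk_300 : WinK.allRange (BondK.checkRowC 10 4 6 6192 9305 100435 99567 100000 99999 100000 ChainMemZ6C10.syms ChainMemZ6C10.tree) 300 400 = true :=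
  WinK.allRange_of_allRangeB (fuel := 8) (lo := 300) (len := 100) (by decide +kernel)

set_option maxHeartbeats 0 in
/-- Rows `[400, 500)` pass the check. [folklore] -/
theorem chk_400 : WinK.allRange (BondK.checkRowC 10 4 6 6192 9305 100435 99567 100000 99999 100000 ChainMemZ6C10.syms ChainMemZ6C10.tree) 400 500 = true :=
  WinK.allRange_of_allRangeB (fuel := 8) (lo := 400) (len := 100) (by decide +kernel)

set_option maxHeartbeats 0 in
/-- Rows `[500, 600)` pass the check. [folklore] -/
theorem chk_500 : WinK.allRange (BondK.checkRowC 10 4 6 6192 9305 100435 99567 100000 99999 100000 ChainMemZ6C10.syms ChainMemZ6C10.tree) 500 600 = true :=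
  WinK.allRange_of_allRangeB (fuel := 8) (lo := 500) (len := 100) (by decide +kernel)

/-- Rows `[0, 600)` pass the check. [folklore] -/
theorem file_1 : WinK.allRange (BondK.checkRowC 10 4 6 6192 9305 100435 99567 100000 99999 100000 ChainMemZ6C10.syms ChainMemZ6C10.tree) 0 600 = true := (WinK.allRange_split (WinK.allRange_split (WinK.allRange_split (WinK.allRange_split (WinK.allRange_split chk_0 chk_100) chk_200) chk_300) chk_400) chk_500)

end Summit.CriticalPhenomena.PercolationContinuityZ3.Theorems.Pcint.ChainMemZ6C10
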